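/-
Copyright: the b2b-balaban T⁴-continuum CRUX team, row NE7b OWNER lineage `t4-ne7b-p1` (gen 130). Project licence.
-/
import Summits.QuantumFields.BalabanUV.T4Continuum.Spine.NE7b.SupEffectiveActionCovariance
import Summits.QuantumFields.BalabanUV.T4Continuum.Spine.NE7b.SupSymmetricFormBounds
import Mathlib.Analysis.Calculus.FDeriv.Symmetric

/-!
# THE NEXT REMAINDER RE-ENTERS THE SECOND-ORDER CLASS: at EVERY base field `ψ₀` the next potential `W = −log Z` splits as
#   `W(ψ₀+ψ') = W(ψ₀) + DW(ψ₀)ψ' + ½D²W(ψ₀)[ψ',ψ'] + R⁺(ψ')`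
# with a SYMMETRIC Hessian obeying `−2λ_w·Q ≤ D²W(ψ₀) ≤ Λ_w·Q` on the diagonal and `|D²W(ψ₀)[h,k]| ≤ (4λ_w+Λ_w)·√Q(h)√Q(k)` off it
# (`Q(v) = Σ_{p,x}v_x²`), and a remainder that is TWO-SIDED QUADRATICALLY BOUNDED, `|R⁺(ψ')| ≤ (λ_w + ½Λ_w)·Q(ψ')`, with gradient
# `|DR⁺(ψ')v| ≤ 2(4λ_w+Λ_w)·√Q(ψ')√Q(v)` — the next step's stability ∕ `|w'| ≤ κ₁|t|` letters for the next remainder, NO smallness used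
# (row NE7b, node U5c; (313)∕(316)∕(318)∕(319)∕(320)∕(322a) BY NAME + Mathlib's `second_derivative_symmetric_of_eventually_of_real`;
# [folklore])

Cell `pub-balaban`, sub-cell `t4`, spine estimate NE7b (`T4WeightBudget.RelWeightBound`; the cell's OWN estimate — NOT PRINTED in
[Bałaban 1983–89], NOT PROVED).  Crux-route work under `Spine/NE7b/` by the row OWNER (`t4-ne7b-p1` gen 130, file (322)) under FREEZE
(0)'s crux-prover clause, on § [NE7bP1-G129-HANDOFF] NEXT (ii) (the re-entry of the next remainder — its SECOND-order half); NOTHING of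
Bałaban's is named as a Lean object, valued or asserted; no `T4Continuum/Support` leaf typed; no `def`, no notation; zero `sorry`.  Imports
(BY NAME): the OWNER's (322a) `…SupSymmetricFormBounds` (`abs_apply_le_of_diag_bounds`, `abs_sub_le_of_hasDerivAt_le`, `cellSqBil_apply`,
`cellSqBil_apply_self`), (320) `…SupEffectiveActionCovariance` (`hessian_neg_log_step_le`, `hessian_neg_log_step_ge`), (319)
(`hasFDerivAt_fderiv_neg_log_step`), (316) (`neg_log_step_upper_letter`), (318) (`neg_log_step_lower_letter`), (313)
(`hasFDerivAt_neg_log_step`); Mathlib's `second_derivative_symmetric_of_eventually_of_real`.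

WHY (located).  The road's class is stated by second-order letters on single-site remainders (`−κ₀t² ≤ w ≤ κ₀t²`, `|w'| ≤ κ₁|t|`) plus a
third-order smallness.  For the NEXT step the potential is the non-local `W = −log Z_ψ`; splitting it at the next background `ψ₀` into
value + gradient + Hessian (the quadratic form handed to the next Gaussian) + remainder `R⁺`, the iteration needs `R⁺` in the same
second-order class in the gauge `Q`.  Everything required is already in the tree: the letters (316)∕(318), the `C²` structure (319) and
the letters read on the Hessian (320), the linear algebra of (322a) (Cauchy–Schwarz turns the DIAGONAL Hessian bounds into off-diagonal
ones); what is added here is the symmetry of `D²W` and the mean-value inequality along the segment for the gradient of `R⁺`.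

WHAT IS PROVED ([folklore]; the road's notation of (319)∕(320) with `Γ = M⁻¹`, `M ≻ 0`;
`W = ψ ↦ −log ∫e^{−Σ_{p∈C}Σ_{x∈cell p}w_x(ω_x+ψ_x)}dN(0,M⁻¹)`, `D²W(ψ₀) = fderiv ℝ (fderiv ℝ W) ψ₀`, `Q(v) = Σ_{p,x}v_x²`):
* §1 THE HESSIAN OF THE NEXT POTENTIAL: `fderiv_fderiv_neg_log_step` (`D²W(ψ₀)` is (319)'s closed form), **`hessian_symm`**,
  `hessian_diag_le` (`≤ Λ_wQ(v)`), `hessian_diag_ge` (`≥ −2λ_wQ(v)`), **`abs_hessian_apply_le`** (`|D²W(ψ₀)[h,k]| ≤ (4λ_w+Λ_w)√Q(h)√Q(k)`,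
  via (322a) `abs_apply_le_of_diag_bounds`);
* §2 THE NEXT REMAINDER `R⁺(ψ') = W(ψ₀+ψ') − W(ψ₀) − DW(ψ₀)ψ' − ½D²W(ψ₀)[ψ',ψ']`: **`nextRemainder_ge`** (`≥ −(λ_w + ½Λ_w)Q(ψ')`),
  **`nextRemainder_le`** (`≤ (λ_w + ½Λ_w)Q(ψ')`), **`abs_nextRemainder_fderiv_le`**
  (`|DW(ψ₀+ψ')v − DW(ψ₀)v − D²W(ψ₀)[ψ',v]| ≤ 2(4λ_w+Λ_w)√Q(ψ')√Q(v)`); §3 toy.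

HONEST (what this is NOT).  Second order only: the THIRD-order smallness of `R⁺` (a Lipschitz ∕ Hölder modulus of `ψ ↦ D²W(ψ)`, i.e.
the road's `u″ L-Lipschitz` letter for the next potential, and its `O(ε)` size on small fields) is NOT here and is the successor's; the
constants double ∕ add (`λ_w + ½Λ_w`, `4λ_w + Λ_w`, `Λ_w ≥ 0` assumed) — honest prices of reading letters on the Hessian; positive-definite
covariance ((318)'s dictionary); scalar skeleton ((A3), NC-NE7b-α UNRULED); nothing of Bałaban's asserted.  BY-NAME EFFECT ON THE WALL:
NONE.  NE7b NOT PRINTED ∕ NOT PROVED; spine PROVED 0∕9; rung (B)+1 — the programme's measures remain FINITE-torus statements; NOT the mass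
gap, NOT Clay.  HONEST DEPENDENCY: continuum YM on T⁴ ⇐ BetaPertH ∧ nine spine estimates (0∕9 proved); BetaPertH ⇐ (D1) ∧ (D4) ∧
CAP+tail; G-an2-4 gates asym, D1 and NE2∕3∕4.
-/

set_option autoImplicit false
set_option maxSynthPendingDepth 2

noncomputable section

namespace Summit.QuantumFields.BalabanUV.T4Continuum.NE7b.SupNextRemainderSecondOrder

open MeasureTheory ProbabilityTheory Finset Real Set Filter
open scoped BigOperators Matrix Topology
open SupEffectiveActionCovariance (hessian_neg_log_step_le hessian_neg_log_step_ge)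
open SupEffectiveActionHessian (hasFDerivAt_fderiv_neg_log_step)
open SupEffectiveActionUpperLetter (neg_log_step_upper_letter)
open SupEffectiveActionLowerLetter (neg_log_step_lower_letter)
open SupEffectiveActionDerivative (hasFDerivAt_neg_log_step)
open SupSymmetricFormBounds (abs_apply_le_of_diag_bounds abs_sub_le_of_hasDerivAt_le cellSqBil_apply cellSqBil_apply_self)

variable {ι : Type} [Fintype ι] [DecidableEq ι] {V : Type*}

/-! ## §1. The Hessian of the next potential: symmetric, two-sided on the diagonal, hence bounded off it -/

section Road

variable {M : Matrix ι ι ℝ} {γop m lamw Λw : ℝ} {cell : V → Finset ι} {w w' w'' : ι → ℝ → ℝ} {κ₀ κ₁ κ₂ τ δ θ : ℝ}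

/-- **`D²W(ψ₀)` IS (319)'s CLOSED FORM** (`fderiv` of the gradient map, by uniqueness of the derivative). [folklore] -/
theorem fderiv_fderiv_neg_log_step (hM : M.PosDef) (hΓop : (γop • (1 : Matrix ι ι ℝ) - M⁻¹).PosSemidef)
    (hdisj : ∀ p q, p ≠ q → Disjoint (cell p) (cell q)) (hw' : ∀ x t, HasDerivAt (w x) (w' x t) t)
    (hw'' : ∀ x t, HasDerivAt (w' x) (w'' x t) t) (hw'm : ∀ x, Measurable (w' x)) (hw''m : ∀ x, Measurable (w'' x))
    (hκ₀ : 0 ≤ κ₀) (hκ₁ : 0 ≤ κ₁) (hτ : 0 < τ) (hδ : 0 < δ) (hθ0 : 0 < θ) (hθ1 : θ < 1) (hκθ : (2 * κ₀ * (1 + τ) + 4 * δ) * γop ≤ θ)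
    (hstab : ∀ x, ∀ t : ℝ, -(κ₀ * t ^ 2) ≤ w x t) (hw'b : ∀ x t, |w' x t| ≤ κ₁ * |t|) (hw''b : ∀ x t, |w'' x t| ≤ κ₂)
    (C : Finset V) (ψ₀ : EuclideanSpace ℝ ι) :
    fderiv ℝ (fun ψ : EuclideanSpace ℝ ι => fderiv ℝ (fun φ : EuclideanSpace ℝ ι =>
        -log (∫ ω : EuclideanSpace ℝ ι, exp (-(∑ p ∈ C, ∑ x ∈ cell p, w x (ω x + φ x))) ∂(multivariateGaussian 0 M⁻¹))) ψ) ψ₀ =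
      (∫ ω : EuclideanSpace ℝ ι, exp (-(∑ p ∈ C, ∑ x ∈ cell p, w x (ω x + ψ₀ x))) ∂(multivariateGaussian 0 M⁻¹))⁻¹ •
          (∫ ω : EuclideanSpace ℝ ι, exp (-(∑ p ∈ C, ∑ x ∈ cell p, w x (ω x + ψ₀ x))) •
            ((∑ p ∈ C, ∑ x ∈ cell p, (w'' x (ω x + ψ₀ x)) • ((EuclideanSpace.proj x : EuclideanSpace ℝ ι →L[ℝ] ℝ).smulRight
                (EuclideanSpace.proj x : EuclideanSpace ℝ ι →L[ℝ] ℝ))) -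
              (∑ p ∈ C, ∑ x ∈ cell p, (w' x (ω x + ψ₀ x)) • (EuclideanSpace.proj x : EuclideanSpace ℝ ι →L[ℝ] ℝ)).smulRight
                (∑ p ∈ C, ∑ x ∈ cell p, (w' x (ω x + ψ₀ x)) • (EuclideanSpace.proj x : EuclideanSpace ℝ ι →L[ℝ] ℝ)))
            ∂(multivariateGaussian 0 M⁻¹)) +
        (((∫ ω : EuclideanSpace ℝ ι, exp (-(∑ p ∈ C, ∑ x ∈ cell p, w x (ω x + ψ₀ x))) ∂(multivariateGaussian 0 M⁻¹)) ^ 2)⁻¹ •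
          ∫ ω : EuclideanSpace ℝ ι, exp (-(∑ p ∈ C, ∑ x ∈ cell p, w x (ω x + ψ₀ x))) •
            (∑ p ∈ C, ∑ x ∈ cell p, (w' x (ω x + ψ₀ x)) • (EuclideanSpace.proj x : EuclideanSpace ℝ ι →L[ℝ] ℝ))
            ∂(multivariateGaussian 0 M⁻¹)).smulRight
          (∫ ω : EuclideanSpace ℝ ι, exp (-(∑ p ∈ C, ∑ x ∈ cell p, w x (ω x + ψ₀ x))) •
            (∑ p ∈ C, ∑ x ∈ cell p, (w' x (ω x + ψ₀ x)) • (EuclideanSpace.proj x : EuclideanSpace ℝ ι →L[ℝ] ℝ))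
            ∂(multivariateGaussian 0 M⁻¹)) :=
  (hasFDerivAt_fderiv_neg_log_step hM.inv.posSemidef hΓop hdisj hw' hw'' hw'm hw''m hκ₀ hκ₁ hτ hδ hθ0 hθ1 hκθ hstab hw'b hw''b
    C ψ₀).fderiv

/-- **THE HESSIAN IS SYMMETRIC**: `D²W(ψ₀)[h,k] = D²W(ψ₀)[k,h]` (`W` is differentiable everywhere and its gradient map is differentiable at
`ψ₀`; Mathlib's symmetry of second derivatives over `ℝ`). [folklore] -/
theorem hessian_symm (hM : M.PosDef) (hΓop : (γop • (1 : Matrix ι ι ℝ) - M⁻¹).PosSemidef)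
    (hdisj : ∀ p q, p ≠ q → Disjoint (cell p) (cell q)) (hw' : ∀ x t, HasDerivAt (w x) (w' x t) t)
    (hw'' : ∀ x t, HasDerivAt (w' x) (w'' x t) t) (hw'm : ∀ x, Measurable (w' x)) (hw''m : ∀ x, Measurable (w'' x))
    (hκ₀ : 0 ≤ κ₀) (hκ₁ : 0 ≤ κ₁) (hτ : 0 < τ) (hδ : 0 < δ) (hθ0 : 0 < θ) (hθ1 : θ < 1) (hκθ : (2 * κ₀ * (1 + τ) + 4 * δ) * γop ≤ θ)
    (hstab : ∀ x, ∀ t : ℝ, -(κ₀ * t ^ 2) ≤ w x t) (hw'b : ∀ x t, |w' x t| ≤ κ₁ * |t|) (hw''b : ∀ x t, |w'' x t| ≤ κ₂)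
    (C : Finset V) (ψ₀ h k : EuclideanSpace ℝ ι) :
    fderiv ℝ (fun ψ : EuclideanSpace ℝ ι => fderiv ℝ (fun φ : EuclideanSpace ℝ ι =>
        -log (∫ ω : EuclideanSpace ℝ ι, exp (-(∑ p ∈ C, ∑ x ∈ cell p, w x (ω x + φ x))) ∂(multivariateGaussian 0 M⁻¹))) ψ) ψ₀ h k =
      fderiv ℝ (fun ψ : EuclideanSpace ℝ ι => fderiv ℝ (fun φ : EuclideanSpace ℝ ι =>
        -log (∫ ω : EuclideanSpace ℝ ι, exp (-(∑ p ∈ C, ∑ x ∈ cell p, w x (ω x + φ x))) ∂(multivariateGaussian 0 M⁻¹))) ψ) ψ₀ k h := by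
  have hΓ : (M⁻¹).PosSemidef := hM.inv.posSemidef
  exact second_derivative_symmetric_of_eventually_of_real (x := ψ₀) (f := fun φ : EuclideanSpace ℝ ι =>
      -log (∫ ω : EuclideanSpace ℝ ι, exp (-(∑ p ∈ C, ∑ x ∈ cell p, w x (ω x + φ x))) ∂(multivariateGaussian 0 M⁻¹)))
    (Eventually.of_forall fun ψ =>
      (hasFDerivAt_neg_log_step hΓ hΓop hdisj hw' hw'm hκ₀ hκ₁ hτ hδ hθ0 hθ1 hκθ hstab hw'b C ψ).differentiableAt.hasFDerivAt)
    ((hasFDerivAt_fderiv_neg_log_step hΓ hΓop hdisj hw' hw'' hw'm hw''m hκ₀ hκ₁ hτ hδ hθ0 hθ1 hκθ hstab hw'b hw''b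
      C ψ₀).differentiableAt.hasFDerivAt) h k

/-- **UPPER DIAGONAL**: under (316)'s letter of constant `Λ_w` (and `w ≤ κ₀t²`, `6κ₀(1+τ)γ_op ≤ θ`), `D²W(ψ₀)[v,v] ≤ Λ_w·Q(v)`. [folklore] -/
theorem hessian_diag_le (hM : M.PosDef) (hΓop : (γop • (1 : Matrix ι ι ℝ) - M⁻¹).PosSemidef)
    (hdisj : ∀ p q, p ≠ q → Disjoint (cell p) (cell q)) (hw' : ∀ x t, HasDerivAt (w x) (w' x t) t)
    (hw'' : ∀ x t, HasDerivAt (w' x) (w'' x t) t) (hw'm : ∀ x, Measurable (w' x)) (hw''m : ∀ x, Measurable (w'' x))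
    (hκ₀ : 0 ≤ κ₀) (hκ₁ : 0 ≤ κ₁) (hτ : 0 < τ) (hδ : 0 < δ) (hθ0 : 0 < θ) (hθ1 : θ < 1) (hκθ : (2 * κ₀ * (1 + τ) + 4 * δ) * γop ≤ θ)
    (hκθ₆ : 6 * κ₀ * (1 + τ) * γop ≤ θ) (hstab : ∀ x, ∀ t : ℝ, -(κ₀ * t ^ 2) ≤ w x t) (hquad : ∀ x, ∀ t : ℝ, w x t ≤ κ₀ * t ^ 2)
    (hw'b : ∀ x t, |w' x t| ≤ κ₁ * |t|) (hw''b : ∀ x t, |w'' x t| ≤ κ₂)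
    (hwup : ∀ x (a b : ℝ), w x b ≤ w x a + w' x a * (b - a) + Λw / 2 * (b - a) ^ 2) (C : Finset V) (ψ₀ v : EuclideanSpace ℝ ι) :
    fderiv ℝ (fun ψ : EuclideanSpace ℝ ι => fderiv ℝ (fun φ : EuclideanSpace ℝ ι =>
        -log (∫ ω : EuclideanSpace ℝ ι, exp (-(∑ p ∈ C, ∑ x ∈ cell p, w x (ω x + φ x))) ∂(multivariateGaussian 0 M⁻¹))) ψ) ψ₀ v v ≤
      Λw * ∑ p ∈ C, ∑ x ∈ cell p, v x ^ 2 := by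
  rw [fderiv_fderiv_neg_log_step hM hΓop hdisj hw' hw'' hw'm hw''m hκ₀ hκ₁ hτ hδ hθ0 hθ1 hκθ hstab hw'b hw''b C ψ₀]
  exact hessian_neg_log_step_le hM.inv.posSemidef hΓop hdisj hw' hw'' hw'm hw''m hκ₀ hκ₁ hτ hδ hθ0 hθ1 hκθ hκθ₆ hstab hquad hw'b
    hw''b hwup C ψ₀ v

/-- **LOWER DIAGONAL**: under (318)'s letter of constant `λ_w` (`2λ_w ≤ m`, `m` the floor of `M`), `−2λ_w·Q(v) ≤ D²W(ψ₀)[v,v]`. [folklore] -/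
theorem hessian_diag_ge (hM : M.PosDef) (hfl : ∀ z : ι → ℝ, m * ∑ i, z i ^ 2 ≤ z ⬝ᵥ (M *ᵥ z))
    (hΓop : (γop • (1 : Matrix ι ι ℝ) - M⁻¹).PosSemidef) (hdisj : ∀ p q, p ≠ q → Disjoint (cell p) (cell q))
    (hw' : ∀ x t, HasDerivAt (w x) (w' x t) t) (hw'' : ∀ x t, HasDerivAt (w' x) (w'' x t) t) (hw'm : ∀ x, Measurable (w' x))
    (hw''m : ∀ x, Measurable (w'' x)) (hκ₀ : 0 ≤ κ₀) (hκ₁ : 0 ≤ κ₁) (hτ : 0 < τ) (hδ : 0 < δ) (hθ0 : 0 < θ) (hθ1 : θ < 1)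
    (hκθ : (2 * κ₀ * (1 + τ) + 4 * δ) * γop ≤ θ) (hstab : ∀ x, ∀ t : ℝ, -(κ₀ * t ^ 2) ≤ w x t) (hw'b : ∀ x t, |w' x t| ≤ κ₁ * |t|)
    (hw''b : ∀ x t, |w'' x t| ≤ κ₂) (hlamw : 0 ≤ lamw) (hwlo : ∀ u (a b : ℝ), w u a + w' u a * (b - a) - lamw / 2 * (b - a) ^ 2 ≤ w u b)
    (hm : 2 * lamw ≤ m) (C : Finset V) (ψ₀ v : EuclideanSpace ℝ ι) :
    -(2 * lamw * ∑ p ∈ C, ∑ x ∈ cell p, v x ^ 2) ≤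
      fderiv ℝ (fun ψ : EuclideanSpace ℝ ι => fderiv ℝ (fun φ : EuclideanSpace ℝ ι =>
        -log (∫ ω : EuclideanSpace ℝ ι, exp (-(∑ p ∈ C, ∑ x ∈ cell p, w x (ω x + φ x))) ∂(multivariateGaussian 0 M⁻¹))) ψ) ψ₀ v v := by
  rw [fderiv_fderiv_neg_log_step hM hΓop hdisj hw' hw'' hw'm hw''m hκ₀ hκ₁ hτ hδ hθ0 hθ1 hκθ hstab hw'b hw''b C ψ₀]
  exact hessian_neg_log_step_ge hM hfl hΓop hdisj hw' hw'' hw'm hw''m hκ₀ hκ₁ hτ hδ hθ0 hθ1 hκθ hstab hw'b hw''b hlamw hwlo hm C ψ₀ v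

/-- **THE HESSIAN IS BOUNDED OFF THE DIAGONAL IN THE GAUGE**: under both letters (`Λ_w ≥ 0`),
`|D²W(ψ₀)[h,k]| ≤ (4λ_w + Λ_w)·√Q(h)·√Q(k)` at EVERY `ψ₀, h, k`. [folklore] -/
theorem abs_hessian_apply_le (hM : M.PosDef) (hfl : ∀ z : ι → ℝ, m * ∑ i, z i ^ 2 ≤ z ⬝ᵥ (M *ᵥ z))
    (hΓop : (γop • (1 : Matrix ι ι ℝ) - M⁻¹).PosSemidef) (hdisj : ∀ p q, p ≠ q → Disjoint (cell p) (cell q))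
    (hw' : ∀ x t, HasDerivAt (w x) (w' x t) t) (hw'' : ∀ x t, HasDerivAt (w' x) (w'' x t) t) (hw'm : ∀ x, Measurable (w' x))
    (hw''m : ∀ x, Measurable (w'' x)) (hκ₀ : 0 ≤ κ₀) (hκ₁ : 0 ≤ κ₁) (hτ : 0 < τ) (hδ : 0 < δ) (hθ0 : 0 < θ) (hθ1 : θ < 1)
    (hκθ : (2 * κ₀ * (1 + τ) + 4 * δ) * γop ≤ θ) (hκθ₆ : 6 * κ₀ * (1 + τ) * γop ≤ θ) (hstab : ∀ x, ∀ t : ℝ, -(κ₀ * t ^ 2) ≤ w x t)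
    (hquad : ∀ x, ∀ t : ℝ, w x t ≤ κ₀ * t ^ 2) (hw'b : ∀ x t, |w' x t| ≤ κ₁ * |t|) (hw''b : ∀ x t, |w'' x t| ≤ κ₂) (hlamw : 0 ≤ lamw)
    (hΛw : 0 ≤ Λw) (hwlo : ∀ u (a b : ℝ), w u a + w' u a * (b - a) - lamw / 2 * (b - a) ^ 2 ≤ w u b)
    (hwup : ∀ x (a b : ℝ), w x b ≤ w x a + w' x a * (b - a) + Λw / 2 * (b - a) ^ 2) (hm : 2 * lamw ≤ m) (C : Finset V)
    (ψ₀ h k : EuclideanSpace ℝ ι) :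
    |fderiv ℝ (fun ψ : EuclideanSpace ℝ ι => fderiv ℝ (fun φ : EuclideanSpace ℝ ι =>
        -log (∫ ω : EuclideanSpace ℝ ι, exp (-(∑ p ∈ C, ∑ x ∈ cell p, w x (ω x + φ x))) ∂(multivariateGaussian 0 M⁻¹))) ψ) ψ₀ h k| ≤
      (4 * lamw + Λw) * Real.sqrt (∑ p ∈ C, ∑ x ∈ cell p, h x ^ 2) * Real.sqrt (∑ p ∈ C, ∑ x ∈ cell p, k x ^ 2) := by
  have key := abs_apply_le_of_diag_bounds
    (fderiv ℝ (fun ψ : EuclideanSpace ℝ ι => fderiv ℝ (fun φ : EuclideanSpace ℝ ι =>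
        -log (∫ ω : EuclideanSpace ℝ ι, exp (-(∑ p ∈ C, ∑ x ∈ cell p, w x (ω x + φ x))) ∂(multivariateGaussian 0 M⁻¹))) ψ) ψ₀)
    (∑ p ∈ C, ∑ x ∈ cell p, (EuclideanSpace.proj x : EuclideanSpace ℝ ι →L[ℝ] ℝ).smulRight
        (EuclideanSpace.proj x : EuclideanSpace ℝ ι →L[ℝ] ℝ))
    (hessian_symm hM hΓop hdisj hw' hw'' hw'm hw''m hκ₀ hκ₁ hτ hδ hθ0 hθ1 hκθ hstab hw'b hw''b C ψ₀)
    (fun h k => by rw [cellSqBil_apply, cellSqBil_apply]; exact sum_congr rfl fun p _ => sum_congr rfl fun x _ => mul_comm _ _)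
    (fun v => by rw [cellSqBil_apply_self]; positivity) (a := 2 * lamw) (b := Λw) (by positivity) (by positivity)
    (fun v => by
      rw [cellSqBil_apply_self]
      exact hessian_diag_ge hM hfl hΓop hdisj hw' hw'' hw'm hw''m hκ₀ hκ₁ hτ hδ hθ0 hθ1 hκθ hstab hw'b hw''b hlamw hwlo hm C ψ₀ v)
    (fun v => by
      rw [cellSqBil_apply_self]
      exact hessian_diag_le hM hΓop hdisj hw' hw'' hw'm hw''m hκ₀ hκ₁ hτ hδ hθ0 hθ1 hκθ hκθ₆ hstab hquad hw'b hw''b hwup C ψ₀ v)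
    h k
  rw [cellSqBil_apply_self, cellSqBil_apply_self] at key
  have e : 2 * (2 * lamw) + Λw = 4 * lamw + Λw := by ring
  rw [e] at key
  exact key

/-! ## §2. THE END: the next remainder is two-sided quadratically bounded, with a gradient Lipschitz in the gauge -/

/-- **THE NEXT REMAINDER IS STABLE**: `R⁺(ψ') = W(ψ₀+ψ') − W(ψ₀) − DW(ψ₀)ψ' − ½D²W(ψ₀)[ψ',ψ'] ≥ −(λ_w + ½Λ_w)·Q(ψ')` at EVERY `ψ₀, ψ'`
(the lower letter (318) at `(ψ₀, ψ₀+ψ')` and the upper diagonal Hessian bound). [folklore] -/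
theorem nextRemainder_ge (hM : M.PosDef) (hfl : ∀ z : ι → ℝ, m * ∑ i, z i ^ 2 ≤ z ⬝ᵥ (M *ᵥ z))
    (hΓop : (γop • (1 : Matrix ι ι ℝ) - M⁻¹).PosSemidef) (hdisj : ∀ p q, p ≠ q → Disjoint (cell p) (cell q))
    (hw' : ∀ x t, HasDerivAt (w x) (w' x t) t) (hw'' : ∀ x t, HasDerivAt (w' x) (w'' x t) t) (hw'm : ∀ x, Measurable (w' x))
    (hw''m : ∀ x, Measurable (w'' x)) (hκ₀ : 0 ≤ κ₀) (hκ₁ : 0 ≤ κ₁) (hτ : 0 < τ) (hδ : 0 < δ) (hθ0 : 0 < θ) (hθ1 : θ < 1)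
    (hκθ : (2 * κ₀ * (1 + τ) + 4 * δ) * γop ≤ θ) (hκθ₆ : 6 * κ₀ * (1 + τ) * γop ≤ θ) (hstab : ∀ x, ∀ t : ℝ, -(κ₀ * t ^ 2) ≤ w x t)
    (hquad : ∀ x, ∀ t : ℝ, w x t ≤ κ₀ * t ^ 2) (hw'b : ∀ x t, |w' x t| ≤ κ₁ * |t|) (hw''b : ∀ x t, |w'' x t| ≤ κ₂) (hlamw : 0 ≤ lamw)
    (hwlo : ∀ u (a b : ℝ), w u a + w' u a * (b - a) - lamw / 2 * (b - a) ^ 2 ≤ w u b)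
    (hwup : ∀ x (a b : ℝ), w x b ≤ w x a + w' x a * (b - a) + Λw / 2 * (b - a) ^ 2) (hm : 2 * lamw ≤ m) (C : Finset V)
    (ψ₀ ψ' : EuclideanSpace ℝ ι) :
    -((lamw + Λw / 2) * ∑ p ∈ C, ∑ x ∈ cell p, ψ' x ^ 2) ≤
      -log (∫ ω : EuclideanSpace ℝ ι, exp (-(∑ p ∈ C, ∑ x ∈ cell p, w x (ω x + (ψ₀ + ψ') x))) ∂(multivariateGaussian 0 M⁻¹)) -
        -log (∫ ω : EuclideanSpace ℝ ι, exp (-(∑ p ∈ C, ∑ x ∈ cell p, w x (ω x + ψ₀ x))) ∂(multivariateGaussian 0 M⁻¹)) -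
        fderiv ℝ (fun φ : EuclideanSpace ℝ ι =>
          -log (∫ ω : EuclideanSpace ℝ ι, exp (-(∑ p ∈ C, ∑ x ∈ cell p, w x (ω x + φ x))) ∂(multivariateGaussian 0 M⁻¹))) ψ₀ ψ' -
        1 / 2 * fderiv ℝ (fun ψ : EuclideanSpace ℝ ι => fderiv ℝ (fun φ : EuclideanSpace ℝ ι =>
          -log (∫ ω : EuclideanSpace ℝ ι, exp (-(∑ p ∈ C, ∑ x ∈ cell p, w x (ω x + φ x))) ∂(multivariateGaussian 0 M⁻¹))) ψ) ψ₀
          ψ' ψ' := by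
  have hlow := neg_log_step_lower_letter hM hfl hΓop hdisj hw' hw'm hκ₀ hκ₁ hτ hδ hθ0 hθ1 hκθ hstab hw'b hlamw hwlo hm C ψ₀
    (ψ₀ + ψ')
  have hH := hessian_diag_le hM hΓop hdisj hw' hw'' hw'm hw''m hκ₀ hκ₁ hτ hδ hθ0 hθ1 hκθ hκθ₆ hstab hquad hw'b hw''b hwup C ψ₀ ψ'
  rw [add_sub_cancel_left] at hlow
  have e : ∑ p ∈ C, ∑ u ∈ cell p, ((ψ₀ + ψ') u - ψ₀ u) ^ 2 = ∑ p ∈ C, ∑ x ∈ cell p, ψ' x ^ 2 :=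
    sum_congr rfl fun p _ => sum_congr rfl fun x _ => by simp only [PiLp.add_apply, add_sub_cancel_left]
  rw [e] at hlow
  nlinarith [hlow, hH]

/-- **THE NEXT REMAINDER IS QUADRATICALLY BOUNDED ABOVE**: `R⁺(ψ') ≤ (λ_w + ½Λ_w)·Q(ψ')` at EVERY `ψ₀, ψ'` (the upper letter (316) at
`(ψ₀, ψ₀+ψ')` and the lower diagonal Hessian bound). [folklore] -/
theorem nextRemainder_le (hM : M.PosDef) (hfl : ∀ z : ι → ℝ, m * ∑ i, z i ^ 2 ≤ z ⬝ᵥ (M *ᵥ z))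
    (hΓop : (γop • (1 : Matrix ι ι ℝ) - M⁻¹).PosSemidef) (hdisj : ∀ p q, p ≠ q → Disjoint (cell p) (cell q))
    (hw' : ∀ x t, HasDerivAt (w x) (w' x t) t) (hw'' : ∀ x t, HasDerivAt (w' x) (w'' x t) t) (hw'm : ∀ x, Measurable (w' x))
    (hw''m : ∀ x, Measurable (w'' x)) (hκ₀ : 0 ≤ κ₀) (hκ₁ : 0 ≤ κ₁) (hτ : 0 < τ) (hδ : 0 < δ) (hθ0 : 0 < θ) (hθ1 : θ < 1)
    (hκθ : (2 * κ₀ * (1 + τ) + 4 * δ) * γop ≤ θ) (hκθ₆ : 6 * κ₀ * (1 + τ) * γop ≤ θ) (hstab : ∀ x, ∀ t : ℝ, -(κ₀ * t ^ 2) ≤ w x t)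
    (hquad : ∀ x, ∀ t : ℝ, w x t ≤ κ₀ * t ^ 2) (hw'b : ∀ x t, |w' x t| ≤ κ₁ * |t|) (hw''b : ∀ x t, |w'' x t| ≤ κ₂) (hlamw : 0 ≤ lamw)
    (hwlo : ∀ u (a b : ℝ), w u a + w' u a * (b - a) - lamw / 2 * (b - a) ^ 2 ≤ w u b)
    (hwup : ∀ x (a b : ℝ), w x b ≤ w x a + w' x a * (b - a) + Λw / 2 * (b - a) ^ 2) (hm : 2 * lamw ≤ m) (C : Finset V)
    (ψ₀ ψ' : EuclideanSpace ℝ ι) :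
    -log (∫ ω : EuclideanSpace ℝ ι, exp (-(∑ p ∈ C, ∑ x ∈ cell p, w x (ω x + (ψ₀ + ψ') x))) ∂(multivariateGaussian 0 M⁻¹)) -
        -log (∫ ω : EuclideanSpace ℝ ι, exp (-(∑ p ∈ C, ∑ x ∈ cell p, w x (ω x + ψ₀ x))) ∂(multivariateGaussian 0 M⁻¹)) -
        fderiv ℝ (fun φ : EuclideanSpace ℝ ι =>
          -log (∫ ω : EuclideanSpace ℝ ι, exp (-(∑ p ∈ C, ∑ x ∈ cell p, w x (ω x + φ x))) ∂(multivariateGaussian 0 M⁻¹))) ψ₀ ψ' -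
        1 / 2 * fderiv ℝ (fun ψ : EuclideanSpace ℝ ι => fderiv ℝ (fun φ : EuclideanSpace ℝ ι =>
          -log (∫ ω : EuclideanSpace ℝ ι, exp (-(∑ p ∈ C, ∑ x ∈ cell p, w x (ω x + φ x))) ∂(multivariateGaussian 0 M⁻¹))) ψ) ψ₀
          ψ' ψ' ≤
      (lamw + Λw / 2) * ∑ p ∈ C, ∑ x ∈ cell p, ψ' x ^ 2 := by
  have hup := neg_log_step_upper_letter hM.inv.posSemidef hΓop hdisj hw' hw'm hκ₀ hκ₁ hτ hδ hθ0 hθ1 hκθ hκθ₆ hstab hquad hw'b hwup C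
    ψ₀ (ψ₀ + ψ')
  have hH := hessian_diag_ge hM hfl hΓop hdisj hw' hw'' hw'm hw''m hκ₀ hκ₁ hτ hδ hθ0 hθ1 hκθ hstab hw'b hw''b hlamw hwlo hm C ψ₀ ψ'
  rw [add_sub_cancel_left] at hup
  have e : ∑ p ∈ C, ∑ x ∈ cell p, ((ψ₀ + ψ') x - ψ₀ x) ^ 2 = ∑ p ∈ C, ∑ x ∈ cell p, ψ' x ^ 2 :=
    sum_congr rfl fun p _ => sum_congr rfl fun x _ => by simp only [PiLp.add_apply, add_sub_cancel_left]
  rw [e] at hup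
  nlinarith [hup, hH]

/-- **THE NEXT REMAINDER'S GRADIENT IS LIPSCHITZ IN THE GAUGE**: at EVERY `ψ₀, ψ', v` (with `Λ_w ≥ 0`),
`|DW(ψ₀+ψ')v − DW(ψ₀)v − D²W(ψ₀)[ψ',v]| ≤ 2(4λ_w + Λ_w)·√Q(ψ')·√Q(v)` — the mean-value inequality along `t ↦ ψ₀ + tψ'` for the scalar
`t ↦ DW(ψ₀+tψ')v − t·D²W(ψ₀)[ψ',v]`, whose derivative `D²W(ψ₀+tψ')[ψ',v] − D²W(ψ₀)[ψ',v]` is bounded by §1 twice. [folklore] -/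
theorem abs_nextRemainder_fderiv_le (hM : M.PosDef) (hfl : ∀ z : ι → ℝ, m * ∑ i, z i ^ 2 ≤ z ⬝ᵥ (M *ᵥ z))
    (hΓop : (γop • (1 : Matrix ι ι ℝ) - M⁻¹).PosSemidef) (hdisj : ∀ p q, p ≠ q → Disjoint (cell p) (cell q))
    (hw' : ∀ x t, HasDerivAt (w x) (w' x t) t) (hw'' : ∀ x t, HasDerivAt (w' x) (w'' x t) t) (hw'm : ∀ x, Measurable (w' x))
    (hw''m : ∀ x, Measurable (w'' x)) (hκ₀ : 0 ≤ κ₀) (hκ₁ : 0 ≤ κ₁) (hτ : 0 < τ) (hδ : 0 < δ) (hθ0 : 0 < θ) (hθ1 : θ < 1)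
    (hκθ : (2 * κ₀ * (1 + τ) + 4 * δ) * γop ≤ θ) (hκθ₆ : 6 * κ₀ * (1 + τ) * γop ≤ θ) (hstab : ∀ x, ∀ t : ℝ, -(κ₀ * t ^ 2) ≤ w x t)
    (hquad : ∀ x, ∀ t : ℝ, w x t ≤ κ₀ * t ^ 2) (hw'b : ∀ x t, |w' x t| ≤ κ₁ * |t|) (hw''b : ∀ x t, |w'' x t| ≤ κ₂) (hlamw : 0 ≤ lamw)
    (hΛw : 0 ≤ Λw) (hwlo : ∀ u (a b : ℝ), w u a + w' u a * (b - a) - lamw / 2 * (b - a) ^ 2 ≤ w u b)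
    (hwup : ∀ x (a b : ℝ), w x b ≤ w x a + w' x a * (b - a) + Λw / 2 * (b - a) ^ 2) (hm : 2 * lamw ≤ m) (C : Finset V)
    (ψ₀ ψ' v : EuclideanSpace ℝ ι) :
    |fderiv ℝ (fun φ : EuclideanSpace ℝ ι =>
          -log (∫ ω : EuclideanSpace ℝ ι, exp (-(∑ p ∈ C, ∑ x ∈ cell p, w x (ω x + φ x))) ∂(multivariateGaussian 0 M⁻¹))) (ψ₀ + ψ') v -
        fderiv ℝ (fun φ : EuclideanSpace ℝ ι =>
          -log (∫ ω : EuclideanSpace ℝ ι, exp (-(∑ p ∈ C, ∑ x ∈ cell p, w x (ω x + φ x))) ∂(multivariateGaussian 0 M⁻¹))) ψ₀ v -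
        fderiv ℝ (fun ψ : EuclideanSpace ℝ ι => fderiv ℝ (fun φ : EuclideanSpace ℝ ι =>
          -log (∫ ω : EuclideanSpace ℝ ι, exp (-(∑ p ∈ C, ∑ x ∈ cell p, w x (ω x + φ x))) ∂(multivariateGaussian 0 M⁻¹))) ψ) ψ₀
          ψ' v| ≤
      2 * (4 * lamw + Λw) * Real.sqrt (∑ p ∈ C, ∑ x ∈ cell p, ψ' x ^ 2) * Real.sqrt (∑ p ∈ C, ∑ x ∈ cell p, v x ^ 2) := by
  have hΓ : (M⁻¹).PosSemidef := hM.inv.posSemidef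
  -- the gradient map `G = fderiv W` is differentiable at every point with derivative `fderiv G`
  have hG : ∀ ψ : EuclideanSpace ℝ ι, HasFDerivAt (fun ψ : EuclideanSpace ℝ ι => fderiv ℝ (fun φ : EuclideanSpace ℝ ι =>
      -log (∫ ω : EuclideanSpace ℝ ι, exp (-(∑ p ∈ C, ∑ x ∈ cell p, w x (ω x + φ x))) ∂(multivariateGaussian 0 M⁻¹))) ψ)
      (fderiv ℝ (fun ψ : EuclideanSpace ℝ ι => fderiv ℝ (fun φ : EuclideanSpace ℝ ι =>
        -log (∫ ω : EuclideanSpace ℝ ι, exp (-(∑ p ∈ C, ∑ x ∈ cell p, w x (ω x + φ x))) ∂(multivariateGaussian 0 M⁻¹))) ψ) ψ) ψ :=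
    fun ψ => (hasFDerivAt_fderiv_neg_log_step hΓ hΓop hdisj hw' hw'' hw'm hw''m hκ₀ hκ₁ hτ hδ hθ0 hθ1 hκθ hstab hw'b hw''b
      C ψ).differentiableAt.hasFDerivAt
  -- the scalar path `g(t) = G(ψ₀ + tψ')v − t·D²W(ψ₀)[ψ',v]` and its derivative
  have hpath : ∀ t : ℝ, HasDerivAt (fun t : ℝ => ψ₀ + t • ψ') ψ' t := fun t => by
    have h := ((hasDerivAt_id t).smul_const ψ').const_add ψ₀
    rwa [one_smul] at h
  have hg : ∀ t : ℝ, HasDerivAt (fun t : ℝ => fderiv ℝ (fun φ : EuclideanSpace ℝ ι =>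
        -log (∫ ω : EuclideanSpace ℝ ι, exp (-(∑ p ∈ C, ∑ x ∈ cell p, w x (ω x + φ x))) ∂(multivariateGaussian 0 M⁻¹))) (ψ₀ + t • ψ') v -
      t * fderiv ℝ (fun ψ : EuclideanSpace ℝ ι => fderiv ℝ (fun φ : EuclideanSpace ℝ ι =>
        -log (∫ ω : EuclideanSpace ℝ ι, exp (-(∑ p ∈ C, ∑ x ∈ cell p, w x (ω x + φ x))) ∂(multivariateGaussian 0 M⁻¹))) ψ) ψ₀ ψ' v)
      (fderiv ℝ (fun ψ : EuclideanSpace ℝ ι => fderiv ℝ (fun φ : EuclideanSpace ℝ ι =>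
        -log (∫ ω : EuclideanSpace ℝ ι, exp (-(∑ p ∈ C, ∑ x ∈ cell p, w x (ω x + φ x))) ∂(multivariateGaussian 0 M⁻¹))) ψ)
          (ψ₀ + t • ψ') ψ' v -
        fderiv ℝ (fun ψ : EuclideanSpace ℝ ι => fderiv ℝ (fun φ : EuclideanSpace ℝ ι =>
          -log (∫ ω : EuclideanSpace ℝ ι, exp (-(∑ p ∈ C, ∑ x ∈ cell p, w x (ω x + φ x))) ∂(multivariateGaussian 0 M⁻¹))) ψ) ψ₀ ψ' v)
      t := by
    intro t
    have h1 := ((hG (ψ₀ + t • ψ')).comp_hasDerivAt t (hpath t))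
    have h2 : HasDerivAt (fun t : ℝ => (fderiv ℝ (fun φ : EuclideanSpace ℝ ι =>
        -log (∫ ω : EuclideanSpace ℝ ι, exp (-(∑ p ∈ C, ∑ x ∈ cell p, w x (ω x + φ x))) ∂(multivariateGaussian 0 M⁻¹)))
        (ψ₀ + t • ψ')) v) ((fderiv ℝ (fun ψ : EuclideanSpace ℝ ι => fderiv ℝ (fun φ : EuclideanSpace ℝ ι =>
        -log (∫ ω : EuclideanSpace ℝ ι, exp (-(∑ p ∈ C, ∑ x ∈ cell p, w x (ω x + φ x))) ∂(multivariateGaussian 0 M⁻¹))) ψ)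
          (ψ₀ + t • ψ') ψ') v) t :=
      ((ContinuousLinearMap.apply ℝ ℝ v).hasFDerivAt.comp_hasDerivAt t h1)
    exact h2.sub ((hasDerivAt_id t).mul_const _ |>.congr_deriv (by rw [one_mul]))
  -- the derivative bound on `[0,1)`: twice §1
  have hb : ∀ t ∈ Ico (0 : ℝ) 1, |fderiv ℝ (fun ψ : EuclideanSpace ℝ ι => fderiv ℝ (fun φ : EuclideanSpace ℝ ι =>
        -log (∫ ω : EuclideanSpace ℝ ι, exp (-(∑ p ∈ C, ∑ x ∈ cell p, w x (ω x + φ x))) ∂(multivariateGaussian 0 M⁻¹))) ψ)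
          (ψ₀ + t • ψ') ψ' v -
        fderiv ℝ (fun ψ : EuclideanSpace ℝ ι => fderiv ℝ (fun φ : EuclideanSpace ℝ ι =>
          -log (∫ ω : EuclideanSpace ℝ ι, exp (-(∑ p ∈ C, ∑ x ∈ cell p, w x (ω x + φ x))) ∂(multivariateGaussian 0 M⁻¹))) ψ) ψ₀ ψ' v| ≤
      2 * (4 * lamw + Λw) * Real.sqrt (∑ p ∈ C, ∑ x ∈ cell p, ψ' x ^ 2) * Real.sqrt (∑ p ∈ C, ∑ x ∈ cell p, v x ^ 2) := by
    intro t _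
    have h1 := abs_hessian_apply_le hM hfl hΓop hdisj hw' hw'' hw'm hw''m hκ₀ hκ₁ hτ hδ hθ0 hθ1 hκθ hκθ₆ hstab hquad hw'b hw''b hlamw
      hΛw hwlo hwup hm C (ψ₀ + t • ψ') ψ' v
    have h2 := abs_hessian_apply_le hM hfl hΓop hdisj hw' hw'' hw'm hw''m hκ₀ hκ₁ hτ hδ hθ0 hθ1 hκθ hκθ₆ hstab hquad hw'b hw''b hlamw
      hΛw hwlo hwup hm C ψ₀ ψ' v
    refine (abs_sub _ _).trans ((add_le_add h1 h2).trans (le_of_eq ?_))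
    ring
  have key := abs_sub_le_of_hasDerivAt_le hg hb
  simp only [one_smul, zero_smul, add_zero, one_mul, zero_mul, sub_zero] at key
  -- `key : |(G(ψ₀+ψ')v − H ψ' v) − G(ψ₀)v| ≤ …`
  have e : fderiv ℝ (fun φ : EuclideanSpace ℝ ι =>
          -log (∫ ω : EuclideanSpace ℝ ι, exp (-(∑ p ∈ C, ∑ x ∈ cell p, w x (ω x + φ x))) ∂(multivariateGaussian 0 M⁻¹))) (ψ₀ + ψ') v -
        fderiv ℝ (fun φ : EuclideanSpace ℝ ι =>
          -log (∫ ω : EuclideanSpace ℝ ι, exp (-(∑ p ∈ C, ∑ x ∈ cell p, w x (ω x + φ x))) ∂(multivariateGaussian 0 M⁻¹))) ψ₀ v -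
        fderiv ℝ (fun ψ : EuclideanSpace ℝ ι => fderiv ℝ (fun φ : EuclideanSpace ℝ ι =>
          -log (∫ ω : EuclideanSpace ℝ ι, exp (-(∑ p ∈ C, ∑ x ∈ cell p, w x (ω x + φ x))) ∂(multivariateGaussian 0 M⁻¹))) ψ) ψ₀
          ψ' v =
      fderiv ℝ (fun φ : EuclideanSpace ℝ ι =>
          -log (∫ ω : EuclideanSpace ℝ ι, exp (-(∑ p ∈ C, ∑ x ∈ cell p, w x (ω x + φ x))) ∂(multivariateGaussian 0 M⁻¹))) (ψ₀ + ψ') v -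
        fderiv ℝ (fun ψ : EuclideanSpace ℝ ι => fderiv ℝ (fun φ : EuclideanSpace ℝ ι =>
          -log (∫ ω : EuclideanSpace ℝ ι, exp (-(∑ p ∈ C, ∑ x ∈ cell p, w x (ω x + φ x))) ∂(multivariateGaussian 0 M⁻¹))) ψ) ψ₀
          ψ' v -
        fderiv ℝ (fun φ : EuclideanSpace ℝ ι =>
          -log (∫ ω : EuclideanSpace ℝ ι, exp (-(∑ p ∈ C, ∑ x ∈ cell p, w x (ω x + φ x))) ∂(multivariateGaussian 0 M⁻¹))) ψ₀ v := by
    ring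
  rw [e]
  exact key

end Road

/-! ## §3. Toy -/

/-- Toy (§2's mean-value letter, from (322a)): `g(t) = 3t` has `|g(1) − g(0)| ≤ 3`. -/
example : |(fun t : ℝ => (3 : ℝ) * t) 1 - (fun t : ℝ => (3 : ℝ) * t) 0| ≤ 3 :=
  abs_sub_le_of_hasDerivAt_le (g' := fun _ => 3) (fun t => ((hasDerivAt_id t).const_mul (3 : ℝ)).congr_deriv (mul_one 3))
    fun t _ => by rw [abs_of_pos three_pos]

end Summit.QuantumFields.BalabanUV.T4Continuum.NE7b.SupNextRemainderSecondOrder
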